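import Mathlib
import Summits.ValiantsHypothesis.ValiantsHypothesis.Theorems.DivisionGapPerMultiplesHardStubTypedDecompositionLL
import Literature.Barriers.ValiantsHypothesis.MonotoneGapParseTrees
import Literature.Barriers.ValiantsHypothesis.MonotoneGapDecomposition
import Literature.Computability.AlgebraicComplexity.ArithCircuitProofs

/-!
# `DivisionGap.PerMultiplesHard` (stmt-ValiantsHypothesis-5068), line `uncharged-face-walk`:
the generic rectangle engine (stub `stub_rectangleBound`)

For `3 ≤ n`, a nonzero torus-homogeneous `g ∈ ℝ≥0[x_ij]` (`n × n` variables; all monomials have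
row margins `R` and column margins `C`) with all `R i ≠ 0` contains a single typed "rectangle"
`supp a + supp b = supp (a · b) ⊆ supp g` carrying a `1 / L(g)` fraction of the monomials of `g`
(`#supp g ≤ L(g) · #supp a · #supp b`), with `a ≠ 0`, `b ≠ 0`, `L(a) ≤ L(g)`,
`L(b) ≤ 8 L(g) + 8`, and `a` torus-homogeneous with margins `(ρ, γ)` whose row support
`k = #{i | ρ i ≠ 0}` satisfies `n < 3k ≤ 2n`.

Proof: the two-sided typed decomposition `g = Σ_{t < s} a_t · b_t`, `s ≤ L(g)`
(`TypedDecompositionLL.stub_typedDecompositionLL` with `D = 3`); no cancellation over `ℝ≥0`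
gives `#supp g ≤ Σ_t #supp (a_t · b_t) ≤ Σ_t #supp a_t · #supp b_t ≤ s · max_t (…)`, and the
maximising index `t₀` is the rectangle (`supp (a_{t₀} · b_{t₀}) ⊆ supp g` by
`support_subset_of_eq_add`).
-/

noncomputable section

-- the namespace is mandated by the crux (`Summit.ValiantsHypothesis.ValiantsHypothesis.…`)
set_option linter.dupNamespace false

open MvPolynomial Literature.Computability.AlgebraicComplexity
open scoped NNReal BigOperators Pointwise
open Literature.Barriers.ValiantsHypothesis
open Summit.ValiantsHypothesis.ValiantsHypothesis.Theorems.DivisionGap.PerMultiplesHard.TypedDecompositionLL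

namespace Summit.ValiantsHypothesis.ValiantsHypothesis.Theorems.DivisionGap.PerMultiplesHard.RectangleBound

/-- The monomial count of a finite sum is at most the sum of the monomial counts. [folklore] -/
theorem card_support_sum_le {σ ι : Type*} (s : Finset ι) (f : ι → MvPolynomial σ ℝ≥0) :
    (∑ t ∈ s, f t).support.card ≤ ∑ t ∈ s, (f t).support.card := by
  classical
  calc (∑ t ∈ s, f t).support.card ≤ (s.biUnion fun t => (f t).support).card :=
        Finset.card_le_card MvPolynomial.support_sum
    _ ≤ ∑ t ∈ s, (f t).support.card := Finset.card_biUnion_le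

/-- The monomial count of a product is at most the product of the monomial counts (the monomials
of `a · b` lie in the sumset `supp a + supp b`). [folklore] -/
theorem card_support_mul_le {σ : Type*} (a b : MvPolynomial σ ℝ≥0) :
    (a * b).support.card ≤ a.support.card * b.support.card := by
  classical
  calc (a * b).support.card ≤ (a.support + b.support).card :=
        Finset.card_le_card (MvPolynomial.support_mul a b)
    _ ≤ a.support.card * b.support.card := Finset.card_add_le

/-- **The rectangle bound for a sum of products.** If `g = Σ_{t : Fin s} a_t · b_t` over `ℝ≥0`
with `g ≠ 0`, then some index `t₀` has `a_{t₀} ≠ 0`, `b_{t₀} ≠ 0`,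
`supp (a_{t₀} · b_{t₀}) ⊆ supp g` and `#supp g ≤ s · (#supp a_{t₀} · #supp b_{t₀})`.
[folklore] -/
theorem exists_rectangle_of_eq_sum {σ : Type*} {s : ℕ} (g : MvPolynomial σ ℝ≥0)
    (a b : Fin s → MvPolynomial σ ℝ≥0) (hsum : g = ∑ t, a t * b t) (hg0 : g ≠ 0) :
    ∃ t₀ : Fin s, a t₀ ≠ 0 ∧ b t₀ ≠ 0 ∧ (a t₀ * b t₀).support ⊆ g.support ∧
      g.support.card ≤ s * ((a t₀).support.card * (b t₀).support.card) := by
  classical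
  -- `s ≠ 0` since an empty sum vanishes
  have hs : (Finset.univ : Finset (Fin s)).Nonempty := by
    rw [Finset.univ_nonempty_iff]
    refine ⟨⟨0, Nat.pos_of_ne_zero ?_⟩⟩
    rintro rfl
    exact hg0 (by rw [hsum]; simp)
  -- the maximising index
  obtain ⟨t₀, -, ht₀⟩ := Finset.exists_max_image Finset.univ
    (fun t => (a t).support.card * (b t).support.card) hs
  have hcard : g.support.card ≤ s * ((a t₀).support.card * (b t₀).support.card) := by
    calc g.support.card = (∑ t, a t * b t).support.card := by rw [← hsum]
      _ ≤ ∑ t, (a t * b t).support.card := card_support_sum_le _ _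
      _ ≤ ∑ t, (a t).support.card * (b t).support.card :=
          Finset.sum_le_sum fun t _ => card_support_mul_le _ _
      _ ≤ (Finset.univ : Finset (Fin s)).card • ((a t₀).support.card * (b t₀).support.card) :=
          Finset.sum_le_card_nsmul _ _ _ fun t ht => ht₀ t ht
      _ = s * ((a t₀).support.card * (b t₀).support.card) := by
          rw [Finset.card_univ, Fintype.card_fin, smul_eq_mul]
  have hsub : (a t₀ * b t₀).support ⊆ g.support := by
    refine support_subset_of_eq_add (q := ∑ t ∈ Finset.univ.erase t₀, a t * b t) ?_
    rw [hsum, Finset.add_sum_erase _ (fun t => a t * b t) (Finset.mem_univ t₀)]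
  have hgcard : g.support.card ≠ 0 := by
    rw [Ne, Finset.card_eq_zero, MvPolynomial.support_eq_empty]
    exact hg0
  refine ⟨t₀, ?_, ?_, hsub, hcard⟩
  · intro h
    rw [h, MvPolynomial.support_zero, Finset.card_empty, zero_mul, mul_zero] at hcard
    exact hgcard (Nat.le_zero.mp hcard)
  · intro h
    rw [h, MvPolynomial.support_zero, Finset.card_empty, mul_zero, mul_zero] at hcard
    exact hgcard (Nat.le_zero.mp hcard)

/-- **The generic rectangle engine** (registered stub `stub_rectangleBound`). For `3 ≤ n`, a
nonzero torus-homogeneous `g` over `ℝ≥0` (all monomials have margins `(R, C)`) with all `R i ≠ 0`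
has a typed rectangle: `a ≠ 0`, `b ≠ 0` with `L(a) ≤ L(g)`, `L(b) ≤ 8 L(g) + 8`,
`supp (a · b) ⊆ supp g`, `#supp g ≤ L(g) · #supp a · #supp b`, and `a` torus-homogeneous with
margins `(ρ, γ)`, `n < 3 · #{i | ρ i ≠ 0} ≤ 2n`: the maximising summand of the two-sided typed
decomposition `stub_typedDecompositionLL` with `D = 3`, by no cancellation over `ℝ≥0`.
[cite: JerrumSnir1982, §3 (Lemma 3.1(iii), Thm. 3.2, proof of Thm. 3.4)] -/
theorem stub_rectangleBound : ∀ (n : ℕ), 3 ≤ n →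
    ∀ (g : MvPolynomial (Fin n × Fin n) ℝ≥0) (R C : Fin n → ℕ),
      (∀ m ∈ g.support, (∀ i, ∑ j, m (i, j) = R i) ∧ (∀ j, ∑ i, m (i, j) = C j)) →
      (∀ i, R i ≠ 0) → g ≠ 0 →
      ∃ a b : MvPolynomial (Fin n × Fin n) ℝ≥0, a ≠ 0 ∧ b ≠ 0 ∧
        complexity a ≤ complexity g ∧ complexity b ≤ 8 * complexity g + 8 ∧
        (a * b).support ⊆ g.support ∧
        g.support.card ≤ complexity g * (a.support.card * b.support.card) ∧
        ∃ ρ γ : Fin n → ℕ,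
          (∀ m ∈ a.support, (∀ i, ∑ j, m (i, j) = ρ i) ∧ (∀ j, ∑ i, m (i, j) = γ j)) ∧
          n < 3 * (Finset.univ.filter fun i => ρ i ≠ 0).card ∧
          3 * (Finset.univ.filter fun i => ρ i ≠ 0).card ≤ 2 * n := by
  intro n hn g R C hg hR hg0
  obtain ⟨s, hsL, a, b, hsum, htyp⟩ := stub_typedDecompositionLL n 3 le_rfl hn g R C hg hR
  obtain ⟨t₀, ha0, hb0, hsub, hcard⟩ := exists_rectangle_of_eq_sum g a b hsum hg0
  obtain ⟨hca, hcb, ρ, γ, hty, hlo, hhi⟩ := htyp t₀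
  exact ⟨a t₀, b t₀, ha0, hb0, hca, hcb, hsub,
    hcard.trans (Nat.mul_le_mul_right _ hsL), ρ, γ, hty, hlo, hhi⟩

end Summit.ValiantsHypothesis.ValiantsHypothesis.Theorems.DivisionGap.PerMultiplesHard.RectangleBound
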